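import Mathlib.MeasureTheory.Integral.Prod
import Mathlib.MeasureTheory.Integral.Bochner.ContinuousLinearMap
import Mathlib.Analysis.Complex.Basic

/-!
# `BalabanImbrieJaffe1984to88.BIJ88Eq5128CondExpect` — T. Bałaban, J. Imbrie, A. Jaffe, *Effective action and cluster properties of the
abelian Higgs model*, Commun. Math. Phys. **114** (1988) 257–315 [BalabanImbrieJaffe1988], Sect. 5.12 *Conditional Integration*, the identity
printed on p. 300 [PDF 44] and the sentence of p. 302 [PDF 46] *"Here dμ^{(k)}_{Λ^{(k)}_{10}} is an uncentered, normalized Gaussian measure"* —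
**THE CONDITIONING IDENTITY IN MEASURE FORM** (the abstract kernel on which the display (5.12.8) p. 303 sits at measure level).

statement-level skeleton of published theorems with citation tags; proofs where landed; nothing here is a claim about the Yang–Mills mass gap

THE PRINTED TEXT (p. 300 [PDF 44], verbatim; transcribed by p10 in `BIJ88Conditioning512` from the renders, re-read this session on
`renders/c2-p044.png`–`c2-p047.png` of the seat folder).  *"5.12. Conditional Integration.  We exploit the simple structure in Λ^{(k)}_{10} by
doing the integrals there with conditioning on Λ^{(k)c}_{10}, Λ^{(k)c*c}_{10}.  The formula we use is a generalization of the following identity for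
scalar fields:
  ∫dφ|_{Λᶜ} F(φ|_{Λᶜ}) ∫dφ|_Λ e^{−⟨Λᶜφ, ΔΛφ⟩} e^{−½⟨φ, Δ_Λφ⟩} G(φ)
    = ∫dφ|_{Λᶜ} F(φ|_{Λᶜ}) ∫dφ|_Λ e^{−⟨Λᶜφ, ΔΛφ⟩} e^{−½⟨φ, Δ_Λφ⟩} × ∫dφ|_Λ G(φ) e^{−½⟨φ, Δ_Λφ⟩} e^{−⟨Λᶜφ, ΔΛφ⟩} / ∫dφ|_Λ e^{−½⟨φ, Δ_Λφ⟩} e^{−⟨Λᶜφ, ΔΛφ⟩}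
    = (∫dφ|_Λ e^{−½⟨φ, Δ_Λφ⟩}) ∫dφ|_{Λᶜ} F(φ|_{Λᶜ}) e^{½⟨Λᶜφ, ΔΛΔ_Λ⁻¹ΛΔΛᶜφ⟩} × (1/𝒩) ∫dφ|_Λ G(φ) e^{−½⟨φ, Δ_Λφ⟩} e^{−⟨Λᶜφ, ΔΛφ⟩}.
Here 𝒩 is equal to the last integral, without G(φ)."*

THE MEASURE FORM (what this file proves; the *"generalization"* the print invokes, stated once for an arbitrary product of two measure spaces so
that the torus display (5.12.8) can sit on it).  EXTERIOR space `(A, μ_A)` (the fields on `Λᶜ` — and any spectator variables), INTERIOR space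
`(I, μ_I)` (the fields on `Λ`), a WEIGHT `W : A × I → ℝ`, `W > 0` (the Gaussian factor `e^{−⟨Λᶜφ, ΔΛφ⟩}e^{−½⟨φ, Δ_Λφ⟩}` of the interior
variables, depending on the exterior ones), an exterior factor `F : A → ℂ` and an arbitrary factor `G : A × I → ℂ`.  Then
(`integral_prod_condition`)
  `∫_{A×I} F(a)·W(a,i)·G(a,i) d(μ_A ⊗ μ_I) = ∫_A F(a)·𝒩(a)·(∫_I G(a,i) dμ_a(i)) dμ_A(a)`,
with `𝒩(a) = ∫_I W(a,i) dμ_I(i)` (*"𝒩 is equal to the last integral, without G"*: `condNorm`) and `μ_a = 𝒩(a)⁻¹·W(a,·)μ_I` (*"an uncentered,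
normalized Gaussian measure"* when `W` is Gaussian: `condMeasure`, a probability measure `isProbabilityMeasure_condMeasure`, with
`∫G dμ_a = 𝒩(a)⁻¹∫W(a,·)G(a,·)dμ_I`: `integral_condMeasure`).  The FIRST printed equality is `fibre_condition` (multiply and divide by `𝒩` in
each fibre), the passage to the iterated form is Fubini.  The Gaussian EVALUATION of `𝒩` (the factor `(∫dφ|_Λ e^{−½⟨φ,Δ_Λφ⟩})·e^{½⟨…⟩}` of
the third printed form) is p10's `BIJ88Conditioning512.calN_eq` / p02's `BIJ88ExteriorForms5121` in real coordinates and is NOT repeated here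
(this file never mentions a Gaussian: the identity holds for every positive integrable weight).

CITATION HEADER (lean-in-tree rule).  Part of the lit-balaban TYPED SKELETON (HOME `run/shared/lean/pub/lit-balaban/`), PHASE-2 proof seat p34
gen 10 (unit `lit-balaban-p34-g10`; TAKING line HOME/STATUS.md 2026-08-22T00:14:36Z), file 1 of the (5.12.8) set (own lineage = the C1/C2
renormalization-transformation line at measure level: (5.2.8) gen 8 → (5.9.6) gen 9 → (5.12.8)).  Row served: **`C2.Eq5.12.8`** of
`HOME/lit-balaban-r16/ROWS-C2-part2.md` (owner r16), support `C2.Eq5.12.1-5.12.7` (the p. 300 identity; p10's `BIJ88Conditioning512` is its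
finite-dimensional real-Gaussian instance `display300`, p02's `BIJ88Measure5127` the coordinate form of `μ_a` — consumed by name in the reading
table of `BIJ88Eq5128Display`, nothing restated).
PDF held: `paper:balaban1988-cmp114-bij-abelian-higgs-effective-action` (journal page = PDF page + 256); pp. 300–303 rendered and read this
session (`renders/c2-p044.png` … `c2-p047.png`, poppler ×2).
WHAT IS PROVED: two defs with bodies (`condNorm`, `condMeasure`) + theorems; 0 `sorry`; no `Prop`-valued fact; standard axioms; Mathlib only.
-/

namespace Literature.MathematicalPhysics.QuantumFieldTheory.BalabanImbrieJaffe1984to88.BIJ88Eq5128CondExpect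

open MeasureTheory
open scoped ENNReal

noncomputable section

variable {I : Type*} [MeasurableSpace I]

/-! ## §1 The normalization `𝒩` and the normalized weighted measure `μ_a` -/

section Cond

variable (μ : Measure I) (w : I → ℝ)

/-- **`𝒩`** — *"Here 𝒩 is equal to the last integral, without G(φ)"* (p. 300): the total weight `∫_I w dμ_I` of the interior fibre (for the print's
Gaussian weight its value is the factor `(∫dφ|_Λ e^{−½⟨φ,Δ_Λφ⟩})e^{½⟨Λᶜφ, ΔΛΔ_Λ⁻¹ΛΔΛᶜφ⟩}`, p10's `BIJ88Conditioning512.calN_eq`).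
[cite: BalabanImbrieJaffe1988, §5.12 p.300] -/
def condNorm : ℝ := ∫ i, w i ∂μ

/-- **`dμ_Λ = 𝒩⁻¹ · w · dμ_I`** — the interior measure re-weighted by `w` and normalized: *"Here dμ^{(k)}_{Λ^{(k)}_{10}} is an uncentered, normalized
Gaussian measure"* (p. 302; for the print's Gaussian `w` this is the measure (5.12.7), p02's `BIJ88Measure5127.mu` in real coordinates).
[cite: BalabanImbrieJaffe1988, (5.12.7) p.302] -/
def condMeasure : Measure I :=
  (∫⁻ i, ENNReal.ofReal (w i) ∂μ)⁻¹ • μ.withDensity fun i => ENNReal.ofReal (w i)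

variable {μ w}

/-- kernel: for a non-negative integrable weight, `𝒩` read in `ℝ≥0∞` is the `lintegral` of the density. [cite: BalabanImbrieJaffe1988, §5.12 p.300] -/
theorem ofReal_condNorm (hw0 : ∀ i, 0 ≤ w i) (hwi : Integrable w μ) :
    ENNReal.ofReal (condNorm μ w) = ∫⁻ i, ENNReal.ofReal (w i) ∂μ :=
  ofReal_integral_eq_lintegral_ofReal hwi (Filter.Eventually.of_forall hw0)

/-- kernel: the `lintegral` of the density is finite and equals `𝒩`. [cite: BalabanImbrieJaffe1988, §5.12 p.300] -/
theorem lintegral_weight_eq (hw0 : ∀ i, 0 ≤ w i) (hwi : Integrable w μ) :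
    ∫⁻ i, ENNReal.ofReal (w i) ∂μ = ENNReal.ofReal (condNorm μ w) :=
  (ofReal_condNorm hw0 hwi).symm

/-- `𝒩 ≥ 0` for a non-negative weight. [cite: BalabanImbrieJaffe1988, §5.12 p.300] -/
theorem condNorm_nonneg (hw0 : ∀ i, 0 ≤ w i) : 0 ≤ condNorm μ w :=
  integral_nonneg hw0

/-- **`𝒩 > 0`** for a strictly positive integrable weight on a non-zero measure space (the print's `𝒩` is a convergent Gaussian integral).
[cite: BalabanImbrieJaffe1988, §5.12 p.300] -/
theorem condNorm_pos [NeZero μ] (hw : ∀ i, 0 < w i) (hwi : Integrable w μ) : 0 < condNorm μ w := by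
  unfold condNorm
  rw [integral_pos_iff_support_of_nonneg (fun i => (hw i).le) hwi]
  have hs : Function.support w = Set.univ := by
    ext i; simp [(hw i).ne']
  rw [hs]
  exact Measure.measure_univ_pos.mpr (NeZero.ne μ)

/-- **`dμ_Λ` is normalized** — a probability measure (`0 < 𝒩 < ∞`). [cite: BalabanImbrieJaffe1988, (5.12.7) p.302] -/
theorem isProbabilityMeasure_condMeasure (hw0 : ∀ i, 0 ≤ w i) (hwi : Integrable w μ) (hN : 0 < condNorm μ w) :
    IsProbabilityMeasure (condMeasure μ w) := by
  constructor
  rw [condMeasure, Measure.smul_apply, withDensity_apply _ MeasurableSet.univ, Measure.restrict_univ,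
    lintegral_weight_eq hw0 hwi, smul_eq_mul]
  exact ENNReal.inv_mul_cancel (by simpa using hN) ENNReal.ofReal_ne_top

/-- **p. 302: *"We make the same translation (5.12.4) in both numerator and denominator of the normalized integral in Λ^{(k)}_{10}. Terms
quadratic in Λ^{(k)c*}_{10}A^{(k)} cancel"*** — at measure level: a positive factor of the weight depending on the exterior field only drops out
of the normalized measure, `𝒩(c·w)⁻¹·(c·w)μ_I = 𝒩(w)⁻¹·wμ_I` (p02's `BIJ88Measure5127.ratio_cancel` in coordinates). [cite: BalabanImbrieJaffe1988, (5.12.7) p.302] -/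
theorem condMeasure_const_mul {c : ℝ} (hc : 0 < c) (hw : Measurable w) :
    condMeasure μ (fun i => c * w i) = condMeasure μ w := by
  have hc' : ENNReal.ofReal c ≠ 0 := by simpa using hc
  have hct : ENNReal.ofReal c ≠ ∞ := ENNReal.ofReal_ne_top
  have hm : Measurable fun i => ENNReal.ofReal (w i) := by fun_prop
  unfold condMeasure
  have h1 : (fun i => ENNReal.ofReal (c * w i)) = ENNReal.ofReal c • fun i => ENNReal.ofReal (w i) := by
    funext i
    simp only [Pi.smul_apply, smul_eq_mul]
    exact ENNReal.ofReal_mul hc.le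
  rw [h1, withDensity_smul _ hm, smul_smul]
  have h2 : ∫⁻ i, (ENNReal.ofReal c • fun i => ENNReal.ofReal (w i)) i ∂μ = ENNReal.ofReal c * ∫⁻ i, ENNReal.ofReal (w i) ∂μ := by
    simp only [Pi.smul_apply, smul_eq_mul]
    exact lintegral_const_mul _ hm
  rw [h2, ENNReal.mul_inv (Or.inl hc') (Or.inl hct), mul_comm (ENNReal.ofReal c)⁻¹, mul_assoc,
    ENNReal.inv_mul_cancel hc' hct, mul_one]

/-- **Integration against `dμ_Λ`**: `∫ G dμ_a = 𝒩⁻¹ · ∫ w·G dμ_I` (*"× (1/𝒩) ∫dφ|_Λ G(φ) e^{−½⟨φ, Δ_Λφ⟩} e^{−⟨Λᶜφ, ΔΛφ⟩}"*), for every `G`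
(no integrability needed: both sides are `0` together otherwise). [cite: BalabanImbrieJaffe1988, §5.12 p.300] -/
theorem integral_condMeasure {E : Type*} [NormedAddCommGroup E] [NormedSpace ℝ E] (hw : Measurable w) (hw0 : ∀ i, 0 ≤ w i)
    (hwi : Integrable w μ) (G : I → E) :
    ∫ i, G i ∂condMeasure μ w = (condNorm μ w)⁻¹ • ∫ i, w i • G i ∂μ := by
  rw [condMeasure, integral_smul_measure, lintegral_weight_eq hw0 hwi, ENNReal.toReal_inv,
    ENNReal.toReal_ofReal (condNorm_nonneg hw0)]
  congr 1
  rw [integral_withDensity_eq_integral_toReal_smul (by fun_prop) (Filter.Eventually.of_forall fun _ => ENNReal.ofReal_lt_top)]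
  refine integral_congr_ae (Filter.Eventually.of_forall fun i => ?_)
  simp only [ENNReal.toReal_ofReal (hw0 i)]

/-- The same for complex integrands written with products: `∫ G dμ_a = 𝒩⁻¹ · ∫ w·G dμ_I`. [cite: BalabanImbrieJaffe1988, §5.12 p.300] -/
theorem integral_condMeasure_mul (hw : Measurable w) (hw0 : ∀ i, 0 ≤ w i) (hwi : Integrable w μ) (G : I → ℂ) :
    ∫ i, G i ∂condMeasure μ w = ((condNorm μ w)⁻¹ : ℝ) * ∫ i, (w i : ℂ) * G i ∂μ := by
  rw [integral_condMeasure hw hw0 hwi G, Complex.real_smul]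
  simp only [Complex.real_smul]

/-- **THE FIRST PRINTED EQUALITY, fibrewise** — *multiply and divide by `𝒩`*: in each exterior fibre,
`∫_I F·w·G dμ_I = F · 𝒩 · ∫_I G dμ_a` (`𝒩 > 0`). [cite: BalabanImbrieJaffe1988, §5.12 p.300] -/
theorem fibre_condition (hw : Measurable w) (hw0 : ∀ i, 0 ≤ w i) (hwi : Integrable w μ) (hN : 0 < condNorm μ w) (F : ℂ) (G : I → ℂ) :
    ∫ i, F * (w i : ℂ) * G i ∂μ = F * (condNorm μ w : ℂ) * ∫ i, G i ∂condMeasure μ w := by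
  rw [integral_condMeasure_mul hw hw0 hwi G]
  have hN' : (condNorm μ w : ℂ) ≠ 0 := by exact_mod_cast hN.ne'
  have e1 : ∫ i, F * (w i : ℂ) * G i ∂μ = F * ∫ i, (w i : ℂ) * G i ∂μ := by
    rw [← integral_const_mul]
    exact integral_congr_ae (Filter.Eventually.of_forall fun i => by ring)
  rw [e1, Complex.ofReal_inv]
  field_simp

end Cond

/-! ## §2 The identity on a product: exterior `A`, interior `I` -/

section Prod

variable {A : Type*} [MeasurableSpace A] {μA : Measure A} {μI : Measure I} [SFinite μA] [SFinite μI]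

/-- **THE CONDITIONING IDENTITY OF p. 300 IN MEASURE FORM** — for an exterior factor `F(a)`, a strictly positive measurable weight `W(a, i)`
integrable in each fibre, and any `G(a, i)` with `F·W·G` integrable on the product:
`∫_{A×I} F(a)·W(a,i)·G(a,i) d(μ_A ⊗ μ_I) = ∫_A F(a) · 𝒩(a) · (∫_I G(a, i) dμ_a(i)) dμ_A(a)`, `𝒩(a) = ∫_I W(a,·)dμ_I`, `μ_a = 𝒩(a)⁻¹W(a,·)μ_I` —
*"(∫dφ|_Λ …) ∫dφ|_{Λᶜ} F(φ|_{Λᶜ}) e^{½⟨…⟩} × (1/𝒩) ∫dφ|_Λ G(φ) e^{−½⟨φ,Δ_Λφ⟩}e^{−⟨Λᶜφ,ΔΛφ⟩}"* with the two `φ|_{Λᶜ}`-dependent factors of the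
third printed form collected as `𝒩(φ|_{Λᶜ})` (Fubini, then `fibre_condition` in each fibre). [cite: BalabanImbrieJaffe1988, §5.12 p.300] -/
theorem integral_prod_condition (F : A → ℂ) {W : A × I → ℝ} (hW : Measurable W) (hW0 : ∀ p, 0 ≤ W p)
    (hWi : ∀ a, Integrable (fun i => W (a, i)) μI) (hN : ∀ a, 0 < condNorm μI (fun i => W (a, i))) (G : A × I → ℂ)
    (hint : Integrable (fun p : A × I => F p.1 * (W p : ℂ) * G p) (μA.prod μI)) :
    ∫ p, F p.1 * (W p : ℂ) * G p ∂μA.prod μI =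
      ∫ a, F a * (condNorm μI (fun i => W (a, i)) : ℂ) * ∫ i, G (a, i) ∂condMeasure μI (fun i => W (a, i)) ∂μA := by
  rw [integral_prod _ hint]
  refine integral_congr_ae (Filter.Eventually.of_forall fun a => ?_)
  exact fibre_condition (hW.comp (measurable_const.prodMk measurable_id)) (fun i => hW0 (a, i)) (hWi a) (hN a) (F a) fun i => G (a, i)

omit [SFinite μA] in
/-- **The exterior integrand after conditioning is integrable** — `a ↦ F(a)·𝒩(a)·∫G dμ_a` is the fibre integral of the integrable `F·W·G`
(so the exterior integral of (5.12.8) converges whenever the display before conditioning does). [cite: BalabanImbrieJaffe1988, (5.12.8) p.303] -/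
theorem integrable_condition (F : A → ℂ) {W : A × I → ℝ} (hW : Measurable W) (hW0 : ∀ p, 0 ≤ W p)
    (hWi : ∀ a, Integrable (fun i => W (a, i)) μI) (hN : ∀ a, 0 < condNorm μI (fun i => W (a, i))) (G : A × I → ℂ)
    (hint : Integrable (fun p : A × I => F p.1 * (W p : ℂ) * G p) (μA.prod μI)) :
    Integrable (fun a => F a * (condNorm μI (fun i => W (a, i)) : ℂ) * ∫ i, G (a, i) ∂condMeasure μI (fun i => W (a, i))) μA := by
  have h := hint.integral_prod_left
  refine h.congr (Filter.Eventually.of_forall fun a => ?_)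
  exact fibre_condition (hW.comp (measurable_const.prodMk measurable_id)) (fun i => hW0 (a, i)) (hWi a) (hN a) (F a) fun i => G (a, i)

/-- **The same identity read through a measure-preserving change of coordinates** `Φ : X → A × I` of a configuration space `(X, μ)` (the
exterior/interior splitting of the lattice fields): `∫_X H dμ = ∫_A F·𝒩·(∫G dμ_a) dμ_A` whenever `H = (F·W·G) ∘ Φ`.
[cite: BalabanImbrieJaffe1988, §5.12 p.300] -/
theorem integral_condition_of_measurePreserving {X : Type*} [MeasurableSpace X] {μ : Measure X} {Φ : X → A × I}
    (hΦ : MeasurePreserving Φ μ (μA.prod μI)) (F : A → ℂ) {W : A × I → ℝ} (hW : Measurable W) (hW0 : ∀ p, 0 ≤ W p)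
    (hWi : ∀ a, Integrable (fun i => W (a, i)) μI) (hN : ∀ a, 0 < condNorm μI (fun i => W (a, i))) (G : A × I → ℂ)
    (hint : Integrable (fun p : A × I => F p.1 * (W p : ℂ) * G p) (μA.prod μI)) {H : X → ℂ}
    (hH : ∀ x, H x = F (Φ x).1 * (W (Φ x) : ℂ) * G (Φ x)) :
    ∫ x, H x ∂μ = ∫ a, F a * (condNorm μI (fun i => W (a, i)) : ℂ) * ∫ i, G (a, i) ∂condMeasure μI (fun i => W (a, i)) ∂μA := by
  have e1 : ∫ x, H x ∂μ = ∫ p, F p.1 * (W p : ℂ) * G p ∂μA.prod μI := by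
    have hm : AEStronglyMeasurable (fun p : A × I => F p.1 * (W p : ℂ) * G p) (Measure.map Φ μ) := by
      rw [hΦ.map_eq]; exact hint.aestronglyMeasurable
    rw [← hΦ.map_eq, integral_map hΦ.measurable.aemeasurable hm]
    exact integral_congr_ae (Filter.Eventually.of_forall fun x => hH x)
  rw [e1, integral_prod_condition F hW hW0 hWi hN G hint]

end Prod

end

end Literature.MathematicalPhysics.QuantumFieldTheory.BalabanImbrieJaffe1984to88.BIJ88Eq5128CondExpect
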